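import Summits.QuantumFields.BalabanUV.Beta.FP.RelInvPeriodisedChartCombRows
import Summits.QuantumFields.BalabanUV.Beta.FP.RelInvPeriodisedEffFormCoarse

/-!
# `BalabanUV.Beta.FP.RelInvPeriodisedChartEffForm` — road «FP» (binder row D1), ROUTE T row **(T-INV)**, CHART-GENERIC EDITION of
# `RelInvPeriodisedEffForm` §3 + `RelInvPeriodisedEffFormCoarse` §4–§5: **(E) THE `μμ` BLOCK OF THE EFFECTIVE FORM, (ID) THE DICTIONARY's `hId` AT ORDER 0,
# (H2) THE SECOND (INV) LETTER — FOR ANY PERIODISABLE RELATIVE-INVERSE CHART**, with the two reading letters of the chart displayed: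
# (iv) the resolvent's multiplier block at the coarse points read on field legs (`hAmm`), (v) the next level's field block (`hff`)

HONEST DEPENDENCY (page 1, mandatory): continuum YM on T⁴ ⇐ BetaPertH ∧ nine spine estimates (0/9 proved); BetaPertH ⇐ (D1) ∧ (D4) ∧
CAP+tail; G-an2-4 gates asym, D1 and NE2/3/4.  HONEST FRAMING (cell contract, verbatim): «discharging `BetaPertH` makes Bałaban's UV
stability UNCONDITIONAL — a real constructive-QFT result; it is NOT the continuum limit and NOT the Clay problem.»  ABSOLUTE RULE (cell
charter, verbatim): «No internally-minted statement may enter as a cited fact. Every hypothesis is either kernel-proved in this package or a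
verbatim quotation of a PUBLISHED theorem with page reference. The manuscript(s) under audit are NOT citable for their own disputed steps — they
are the thing under adjudication; programme-internal (2001/route/tribunal) claims are never citable.»

CONTENT (proofs = the rooted p314950 ∕ `RelInvPeriodisedEffFormCoarse` VERBATIM, the chart abstracted).
* §1 reading arithmetic, any chart: `perF_coarse_inr_inr_eq_of_read` ((iv) ⇒ the periodised multiplier block of `A` at the coarse slots of `fine Lc M′` IS the
  periodised field block of the read kernel `K₂` on `M′`), `perF_inl_inl_of_ff` ((v) ⇒ the periodised field block of `𝕄′` is `w ·` that of `K₂`).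
* §2 (E) `torus_inv_kkt_of_slots_inr_inr_of_relInv` (slot-map form: `K̃⁻¹ (inr (inl a)) (inr (inl a')) = −Â (fμ a) (fμ a')`),
  **`effForm_toBlocks₁₁_of_relInv`** (presentation of record: `(effForm H₀ [Q₁₀;τ₁]).toBlocks₁₁ = Â∘(fμ, fμ)`, `Â := perF M A`).
* §3 (ID) **`hId_order_zero_of_relInv`** (`(effForm H₀ [Q₁₀;τ₁]).toBlocks₁₁ = w⁻¹ • (perF M′ 𝕄′)∘(fields∘g, fields∘g)` from (iv)(v), `w ≠ 0`), (H2) **`torus_h2_of_relInv`**: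
  with a SECOND chart `(A′, 𝕄′)` on the coarse box at root `toSite r′`, the second (INV) letter of the door (the index types of record: instantiate `g := id`, as the instances do).
Instances: rooted (`A = Π̂ᵀ KInvStep Π̂`, `K₂ = E2 (j+1)`, `w = wVH (j+1)`, untouched files) and chart (III′) (`FP/RelInvPeriodisedComb*`).  [folklore]; no `Prop`,
no `def`, nothing cited, 0 sorry; discharges NO binder of row D1; NOT the dictionary's identification of slots (it displays (iv)(v)), NOT (J-a), NOT (T-ID), NOT SDF,
NOT D1, NOT BetaPertH, NOT continuum, NOT Clay; 0 estimates.  Unit `b2b-balaban-beta-d1-formalise-leaf-05` (gen 29), 2026-08-22; no existing file touched.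
-/

noncomputable section

open scoped BigOperators Matrix

namespace Summit.QuantumFields.BalabanUV.Beta.FP.RelInvPeriodisedChartEffForm

open Matrix
open Literature.Probability.LatticeModels (Torus.proj)
open Literature.MathematicalPhysics.QuantumFieldTheory.Balaban1983to89
open Literature.MathematicalPhysics.QuantumFieldTheory.Balaban1983to89.Beta
open Literature.MathematicalPhysics.QuantumFieldTheory.Balaban1983to89.Beta.Composition (kkt)
open Literature.MathematicalPhysics.QuantumFieldTheory.Balaban1983to89.Beta.CompositionSingular (effForm)
open B4TorusKernel.MultiPeriod (translate)
open B5Prop11Plancherel (fine)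
open B6Lemma24Torus (pbox)
open ExpKernelCalculus (MKer shiftK)
open AffineAveraging (Site box toSite)
open OneStepResolventKernel (Fib)
open Summit.QuantumFields.BalabanUV.Beta.TameKernelCalculus (Spr)
open Summit.QuantumFields.BalabanUV.Beta.ChartConjugationRelative (RelInv)
open Summit.QuantumFields.BalabanUV.Beta.AxialDressingRooted (axEc axEc_inl_inl axEc_inr_inr IsCombBondAt)
open Summit.QuantumFields.BalabanUV.Beta.SaddleInverse (regroup)
open Summit.QuantumFields.BalabanUV.Beta.FP.KernelPeriodisationFib (Idx perF perF_apply perZ_apply)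
open Summit.QuantumFields.BalabanUV.Beta.FP.TorusCombForest (baseOf axisOf)
open Summit.QuantumFields.BalabanUV.Beta.FP.TorusCombRows (Res combBondT combRowsT combBondT_eq baseOf_mem_pbox)
open Summit.QuantumFields.BalabanUV.Beta.FP.TorusCombSlots (CombSlot combSlotOf childOf combSlotOf_childOf combSlotOf_val combBondT_injective)
open Summit.QuantumFields.BalabanUV.Beta.FP.RelInvPeriodisedChart (torus_sliced_kkt_of_relInv)
open Summit.QuantumFields.BalabanUV.Beta.FP.RelInvPeriodisedChartCombRows (coarse_det_kkt_ne_zero_of_relInv)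
open Summit.QuantumFields.BalabanUV.Beta.FP.RelInvPeriodisedEffForm (effForm_fromRows_toBlocks₁₁_apply inv_kkt_apply_inr_inr_reindex)
open Summit.QuantumFields.BalabanUV.Beta.FP.RelInvPeriodisedEffFormCoarse (translate_fine_smul)

variable {d : ℕ} {Lc : ℕ} [NeZero Lc]

/-! ## §1 Reading arithmetic, any chart -/

section Reading

variable (M' : Fin (d + 1) → ℕ)

omit [NeZero Lc] in
/-- [folklore] **(R) ANY CHART**: if the resolvent's multiplier block at the coarse points reads a kernel `K₂` on field legs (`hAmm`, letter (iv)), then its periodised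
multiplier block at the coarse slots of `fine Lc M′` (slot map `fμ` reading the coarse points through `g`, `hg`) IS the periodised field block of `K₂` on `M′`. -/
theorem perF_coarse_inr_inr_eq_of_read {A K₂ : MKer (d + 1) (Fib d)}
    (hAmm : ∀ (x y : Fin (d + 1) → ℤ) (m m' : Fin (d + 1)),
      A ((Lc : ℤ) • x) ((Lc : ℤ) • y) (Sum.inr m) (Sum.inr m') = K₂ x y (Sum.inl m) (Sum.inl m'))
    {μ : Type*} (fμ : μ → Idx (fine Lc M') (Fib d)) (g : μ → ↥(pbox M') × Fin (d + 1))
    (hg : ∀ a, ((fμ a).1 : Site (d + 1)) = (Lc : ℤ) • ((g a).1 : Site (d + 1)) ∧ (fμ a).2 = Sum.inr (g a).2) :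
    (perF (fine Lc M') A).submatrix fμ fμ
      = (perF M' K₂).submatrix (fun a => (((g a).1, Sum.inl (g a).2) : Idx M' (Fib d))) (fun a => ((g a).1, Sum.inl (g a).2)) := by
  ext a a'
  obtain ⟨h1, h2⟩ := hg a
  obtain ⟨h1', h2'⟩ := hg a'
  rw [submatrix_apply, submatrix_apply, perF_apply, perF_apply, perZ_apply, perZ_apply, h1, h1', h2, h2']
  refine tsum_congr fun t => ?_
  rw [translate_fine_smul, hAmm]

omit [NeZero Lc] in
/-- [folklore] **(F) ANY CHART**: if the field block of `𝕄′` is `w ·` that of `K₂` (`hff`, letter (v)), so is its periodised field block (entrywise, `tsum_mul_left`). -/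
theorem perF_inl_inl_of_ff {Mh' K₂ : MKer (d + 1) (Fib d)} {w : ℝ}
    (hff : ∀ (x y : Fin (d + 1) → ℤ) (κ l : Fin (d + 1)), Mh' x y (Sum.inl κ) (Sum.inl l) = w * K₂ x y (Sum.inl κ) (Sum.inl l))
    (s s' : ↥(pbox M')) (κ l : Fin (d + 1)) :
    perF M' Mh' (s, Sum.inl κ) (s', Sum.inl l) = w * perF M' K₂ (s, Sum.inl κ) (s', Sum.inl l) := by
  rw [perF_apply, perF_apply, perZ_apply, perZ_apply, ← tsum_mul_left]
  exact tsum_congr fun t => hff _ _ κ l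

end Reading

/-! ## §2 (E) The `μμ` block of the effective form of the comb-sliced periodised system, any chart -/

section EffForm

variable {r : Fin (d + 1) → ℕ} (M : Fin (d + 1) → ℕ) [∀ μ, NeZero (M μ)] {A Mh : MKer (d + 1) (Fib d)}

/-- **[folklore] THE MULTIPLIER–MULTIPLIER ENTRIES OF THE INVERSE OF THE TORUS SLICED KKT, SLOT-MAP FORM, ANY CHART** (p314950's
`torus_inv_kkt_of_slots_inr_inr` with the chart displayed): `(kkt (M̂∘(fν,fν)) [M̂∘(fμ,fν); τ₁])⁻¹ (inr (inl a)) (inr (inl a')) = −Â (fμ a) (fμ a')`, `Â := perF M A`. -/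
theorem torus_inv_kkt_of_slots_inr_inr_of_relInv (ρ : Fin (d + 1) → ℤ) (hM : ∀ i, Lc ∣ M i) (hA : Spr A) (hMh : Spr Mh)
    (hAt : ∀ t : Fin (d + 1) → ℤ, shiftK ((Lc : ℤ) • t) A = A) (hMt : ∀ t : Fin (d + 1) → ℤ, shiftK ((Lc : ℤ) • t) Mh = Mh)
    (hrel : RelInv A Mh (axEc ρ Lc))
    (hmm : ∀ (x y : Fin (d + 1) → ℤ) (κ l : Fin (d + 1)), Mh x y (Sum.inr κ) (Sum.inr l) = 0)
    (hanti : ∀ (x y : Fin (d + 1) → ℤ) (κ l : Fin (d + 1)), Mh x y (Sum.inl κ) (Sum.inr l) = -Mh y x (Sum.inr l) (Sum.inl κ))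
    {ν μ ρ₁ : Type*} [Fintype ν] [Fintype μ] [Fintype ρ₁] [DecidableEq ν] [DecidableEq μ] [DecidableEq ρ₁]
    (fν : ν → Idx M (Fib d)) (fμ : μ → Idx M (Fib d)) (hfν : Function.Injective fν) (hfμ : Function.Injective fμ)
    (hν : ∀ b : ν, ∃ α : Fin (d + 1), (fν b).2 = Sum.inl α) (hμ : ∀ a : μ, ∃ m : Fin (d + 1), (fμ a).2 = Sum.inr m)
    (cb : ρ₁ → ν) (hcb : Function.Injective cb)
    (hlive : ∀ p : Idx M (Fib d),
      axEc ρ Lc p.1 p.1 p.2 p.2 = 1 ↔ (∃ b, b ∉ Set.range cb ∧ fν b = p) ∨ p ∈ Set.range fμ) (a a' : μ) :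
    (kkt ((perF M Mh).submatrix fν fν)
      (fromRows ((perF M Mh).submatrix fμ fν)
        (Matrix.of fun (x : ρ₁) (b : ν) => if b = cb x then (1 : ℝ) else 0)))⁻¹ (Sum.inr (Sum.inl a)) (Sum.inr (Sum.inl a'))
      = -(perF M A (fμ a) (fμ a')) := by
  classical
  set Mp := perF M Mh with hMp
  -- live presentation `f := fν off the comb ⊕ fμ`, dead presentation `g := fν ∘ cb`
  let f : {b : ν // b ∉ Set.range cb} ⊕ μ → Idx M (Fib d) := Sum.elim (fun b => fν b) fμ
  let g : ρ₁ → Idx M (Fib d) := fun x => fν (cb x)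
  have hf : Function.Injective f := by
    rintro (b | a₁) (b' | a₁') h
    · exact congrArg Sum.inl (Subtype.ext (hfν h))
    · obtain ⟨α, hα⟩ := hν b; obtain ⟨m, hm⟩ := hμ a₁'
      have e : (fν b).2 = (fμ a₁').2 := congrArg Prod.snd h; rw [hα, hm] at e; exact absurd e Sum.inl_ne_inr
    · obtain ⟨α, hα⟩ := hν b'; obtain ⟨m, hm⟩ := hμ a₁
      have e : (fμ a₁).2 = (fν b').2 := congrArg Prod.snd h; rw [hα, hm] at e; exact absurd e Sum.inr_ne_inl
    · exact congrArg Sum.inr (hfμ h)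
  have hlive' : ∀ p : Idx M (Fib d), axEc ρ Lc p.1 p.1 p.2 p.2 = 1 ↔ p ∈ Set.range f := by
    intro p
    rw [hlive p]
    constructor
    · rintro (⟨b, hb, rfl⟩ | ⟨a₁, rfl⟩)
      exacts [⟨Sum.inl ⟨b, hb⟩, rfl⟩, ⟨Sum.inr a₁, rfl⟩]
    · rintro ⟨b | a₁, rfl⟩
      exacts [Or.inl ⟨b, b.2, rfl⟩, Or.inr ⟨a₁, rfl⟩]
  obtain ⟨-, hI⟩ := torus_sliced_kkt_of_relInv M ρ hM hA hMh hAt hMt hrel hmm hanti f hf hlive' (fun b => hν b) hμ g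
  let eν : {b : ν // b ∉ Set.range cb} ⊕ ρ₁ ≃ ν :=
    ((Equiv.sumComm _ _).trans (Equiv.sumCongr (Equiv.ofInjective cb hcb) (Equiv.refl _))).trans (Equiv.sumCompl fun b => b ∈ Set.range cb)
  have heν_inl : ∀ b : {b : ν // b ∉ Set.range cb}, eν (Sum.inl b) = b := fun b => rfl
  have heν_inr : ∀ x : ρ₁, eν (Sum.inr x) = cb x := fun x => rfl
  have hsys : kkt ((Mp.submatrix fν fν).submatrix eν eν)
        ((fromRows (Mp.submatrix fμ fν) (Matrix.of fun (x : ρ₁) (b : ν) => if b = cb x then (1 : ℝ) else 0)).submatrix id eν)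
      = kkt (fromBlocks (Mp.submatrix (f ∘ Sum.inl) (f ∘ Sum.inl)) (Mp.submatrix (f ∘ Sum.inl) g) (Mp.submatrix g (f ∘ Sum.inl))
            (Mp.submatrix g g))
          (fromRows (fromCols (Mp.submatrix (f ∘ Sum.inr) (f ∘ Sum.inl)) (Mp.submatrix (f ∘ Sum.inr) g))
            (fromCols (0 : Matrix ρ₁ {b : ν // b ∉ Set.range cb} ℝ) (1 : Matrix ρ₁ ρ₁ ℝ))) := by
    congr 1
    · ext (b | x) (b' | x') <;> rfl
    · ext (a₁ | x) (b' | x') <;> try rfl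
      · simp only [submatrix_apply, id, fromRows_apply_inr, fromCols_apply_inl, of_apply, heν_inl, Matrix.zero_apply]
        exact if_neg fun h : (b' : ν) = cb x => b'.2 ⟨x, h.symm⟩
      · simp only [submatrix_apply, id, fromRows_apply_inr, fromCols_apply_inr, of_apply, heν_inr]
        by_cases h : x = x'
        · subst h; rw [if_pos rfl, Matrix.one_apply_eq]
        · rw [if_neg fun e => h (hcb e).symm, Matrix.one_apply_ne h]
  rw [inv_kkt_apply_inr_inr_reindex _ _ eν (Sum.inl a) (Sum.inl a'), hsys]
  have h := hI (Sum.inr a) (Sum.inr a')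
  simp only [Sum.elim_inr, neg_mul, one_mul] at h
  exact h

set_option synthInstance.maxSize 1024 in
/-- **[folklore] (E) ANY CHART: THE `μμ` BLOCK OF THE EFFECTIVE FORM OF THE COMB-SLICED PERIODISED SYSTEM IS THE PERIODISED MULTIPLIER BLOCK OF THE RESOLVENT** —
at the presentation of record (fields `(s, α) ↦ (s, inl α)`; coarse multipliers by any injective `inr`-valued `fμ` with `hcoarse`; `τ₁ := combRowsT (toSite r) Lc M` on
the field slots): `(effForm H₀ [Q₁₀; τ₁]).toBlocks₁₁ = (perF M A)∘(fμ, fμ)`. -/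
theorem effForm_toBlocks₁₁_of_relInv (hr : r ∈ box (d + 1) Lc) (hM : ∀ i, Lc ∣ M i) (hA : Spr A) (hMh : Spr Mh)
    (hAt : ∀ t : Fin (d + 1) → ℤ, shiftK ((Lc : ℤ) • t) A = A) (hMt : ∀ t : Fin (d + 1) → ℤ, shiftK ((Lc : ℤ) • t) Mh = Mh)
    (hrel : RelInv A Mh (axEc (toSite r) Lc))
    (hmm : ∀ (x y : Fin (d + 1) → ℤ) (κ l : Fin (d + 1)), Mh x y (Sum.inr κ) (Sum.inr l) = 0)
    (hanti : ∀ (x y : Fin (d + 1) → ℤ) (κ l : Fin (d + 1)), Mh x y (Sum.inl κ) (Sum.inr l) = -Mh y x (Sum.inr l) (Sum.inl κ))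
    {μ : Type*} [Fintype μ] [DecidableEq μ] (fμ : μ → Idx M (Fib d)) (hfμ : Function.Injective fμ)
    (hμ : ∀ a : μ, ∃ m : Fin (d + 1), (fμ a).2 = Sum.inr m)
    (hcoarse : ∀ (s : ↥(pbox M)) (m : Fin (d + 1)), ((s, Sum.inr m) : Idx M (Fib d)) ∈ Set.range fμ ↔ Torus.proj Lc (s : Site (d + 1)) = 0) :
    (effForm ((perF M Mh).submatrix (fun b : ↥(pbox M) × Fin (d + 1) => ((b.1, Sum.inl b.2) : Idx M (Fib d)))
          (fun b : ↥(pbox M) × Fin (d + 1) => ((b.1, Sum.inl b.2) : Idx M (Fib d))))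
        (fromRows
          ((perF M Mh).submatrix fμ (fun b : ↥(pbox M) × Fin (d + 1) => ((b.1, Sum.inl b.2) : Idx M (Fib d))))
          ((combRowsT (toSite r) Lc M).submatrix id (fun b : ↥(pbox M) × Fin (d + 1) => ((b.1, Sum.inl b.2) : Idx M (Fib d)))))).toBlocks₁₁
      = (perF M A).submatrix fμ fμ := by
  have hLc : 0 < Lc := Nat.pos_of_ne_zero (NeZero.ne Lc)
  have hρ : ∀ i, 0 ≤ toSite r i ∧ toSite r i < (Lc : ℤ) := fun i => by
    have h := (Fintype.mem_piFinset.mp hr) i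
    rw [Finset.mem_range] at h
    exact ⟨by simp only [toSite]; positivity, by simp only [toSite]; exact_mod_cast h⟩
  set fν : ↥(pbox M) × Fin (d + 1) → Idx M (Fib d) := fun b => (b.1, Sum.inl b.2) with hfν
  -- the comb map read in the field-slot index (p310903 verbatim): `fν (cb x) = combBondT x`
  let cb : Res (toSite r) Lc M → ↥(pbox M) × Fin (d + 1) := fun x =>
    (⟨baseOf (toSite r) Lc x.site, baseOf_mem_pbox hLc hρ hM x⟩, axisOf (toSite r) Lc x.site)
  have hcbf : ∀ x, fν (cb x) = combBondT (toSite r) Lc M x := fun x => by rw [combBondT_eq hLc hρ hM x]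
  have hfν_inj : Function.Injective fν := by
    rintro ⟨s, α⟩ ⟨s', α'⟩ h
    simp only [hfν, Prod.mk.injEq, Sum.inl.injEq] at h
    exact Prod.ext h.1 h.2
  have hcb : Function.Injective cb := fun x y h =>
    combBondT_injective hLc hρ hM (by rw [← hcbf, ← hcbf, h])
  have hτ : (combRowsT (toSite r) Lc M).submatrix id fν = Matrix.of fun x b => if b = cb x then (1 : ℝ) else 0 := by
    ext x b
    rw [submatrix_apply, of_apply, id, combRowsT, ← hcbf]
    by_cases h : b = cb x
    · rw [if_pos (congrArg fν h), if_pos h]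
    · rw [if_neg (fun e => h (hfν_inj e)), if_neg h]
  -- the live reading (p310903 verbatim)
  have hlive : ∀ p : Idx M (Fib d),
      axEc (toSite r) Lc p.1 p.1 p.2 p.2 = 1 ↔ (∃ b, b ∉ Set.range cb ∧ fν b = p) ∨ p ∈ Set.range fμ := by
    rintro ⟨s, α | m⟩
    · rw [axEc_inl_inl]
      constructor
      · intro h
        have hnc : ¬ IsCombBondAt (toSite r) Lc α (s : Site (d + 1)) := fun hc => by
          rw [if_neg (fun h3 => h3.2.2 hc)] at h; exact zero_ne_one h
        refine Or.inl ⟨(s, α), ?_, rfl⟩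
        rintro ⟨x, hx⟩
        have hslot := (combSlotOf (toSite r) Lc M hLc hρ hM x).2
        rw [combSlotOf_val, ← hcbf, hx] at hslot
        obtain ⟨m', hm', hc'⟩ := hslot
        have e : α = m' := Sum.inl_injective hm'
        subst e
        exact hnc hc'
      · rintro (⟨b, hb, hbp⟩ | ⟨a₁, ha⟩)
        · have hbs : b = (s, α) := hfν_inj hbp
          subst hbs
          have hnc : ¬ IsCombBondAt (toSite r) Lc α (s : Site (d + 1)) := fun hc => by
            apply hb
            let q : CombSlot (toSite r) Lc M := ⟨(s, Sum.inl α), α, rfl, hc⟩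
            refine ⟨childOf (toSite r) Lc M hLc hM q, hfν_inj ?_⟩
            rw [hcbf, ← combSlotOf_val hLc hρ hM, combSlotOf_childOf hLc hρ hM q]
          rw [if_pos ⟨rfl, rfl, hnc⟩]
        · obtain ⟨m, hm⟩ := hμ a₁
          rw [ha] at hm
          exact absurd hm Sum.inl_ne_inr
    · rw [axEc_inr_inr]
      constructor
      · intro h
        have hps : Torus.proj Lc (s : Site (d + 1)) = 0 := by
          by_contra hc
          rw [if_neg (fun h3 => hc h3.2.2)] at h; exact zero_ne_one h
        exact Or.inr ((hcoarse s m).2 hps)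
      · rintro (⟨b, -, hbp⟩ | ha)
        · exact absurd (congrArg Prod.snd hbp) Sum.inl_ne_inr
        · rw [if_pos ⟨rfl, rfl, (hcoarse s m).1 ha⟩]
  ext a a'
  rw [effForm_fromRows_toBlocks₁₁_apply, hτ,
    torus_inv_kkt_of_slots_inr_inr_of_relInv M (toSite r) hM hA hMh hAt hMt hrel hmm hanti fν fμ hfν_inj hfμ (fun b => ⟨b.2, rfl⟩) hμ cb hcb
      hlive a a', neg_neg, submatrix_apply]

end EffForm

/-! ## §3 (ID) the dictionary's `hId` at order 0 and (H2) the second (INV) letter, any chart -/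

section Identification

variable {r r' : Fin (d + 1) → ℕ} (M' : Fin (d + 1) → ℕ) [∀ i, NeZero (M' i)] {A Mh A' Mh' K₂ : MKer (d + 1) (Fib d)} {w : ℝ}

set_option synthInstance.maxSize 1024 in
/-- **[folklore] (ID) `hId` AT ORDER 0 AS A THEOREM, ANY CHART.**  A chart `(A, 𝕄)` on the fine box `fine Lc M′` at root `toSite r` (seven letters); the coarse multipliers
presented by any injective `inr`-valued `fμ` (range = the multiplier slots at the coarse points, `hcoarse`) reading those points through `g` (`hg`); letters (iv) `hAmm`
(the resolvent's coarse multiplier block reads `K₂` on field legs) and (v) `hff` (the field block of the next-level bordered Hessian `𝕄′` is `w · K₂`'s), `w ≠ 0`.  THEN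
`(effForm H₀ [Q₁₀; τ₁]).toBlocks₁₁ = w⁻¹ • (perF M′ 𝕄′)∘(fields∘g, fields∘g)`. -/
theorem hId_order_zero_of_relInv (hr : r ∈ box (d + 1) Lc) (hA : Spr A) (hMh : Spr Mh)
    (hAt : ∀ t : Fin (d + 1) → ℤ, shiftK ((Lc : ℤ) • t) A = A) (hMt : ∀ t : Fin (d + 1) → ℤ, shiftK ((Lc : ℤ) • t) Mh = Mh)
    (hrel : RelInv A Mh (axEc (toSite r) Lc))
    (hmm : ∀ (x y : Fin (d + 1) → ℤ) (κ l : Fin (d + 1)), Mh x y (Sum.inr κ) (Sum.inr l) = 0)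
    (hanti : ∀ (x y : Fin (d + 1) → ℤ) (κ l : Fin (d + 1)), Mh x y (Sum.inl κ) (Sum.inr l) = -Mh y x (Sum.inr l) (Sum.inl κ))
    (hAmm : ∀ (x y : Fin (d + 1) → ℤ) (m m' : Fin (d + 1)),
      A ((Lc : ℤ) • x) ((Lc : ℤ) • y) (Sum.inr m) (Sum.inr m') = K₂ x y (Sum.inl m) (Sum.inl m'))
    (hff : ∀ (x y : Fin (d + 1) → ℤ) (κ l : Fin (d + 1)), Mh' x y (Sum.inl κ) (Sum.inl l) = w * K₂ x y (Sum.inl κ) (Sum.inl l)) (hw : w ≠ 0)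
    {μ : Type*} [Fintype μ] [DecidableEq μ] (fμ : μ → Idx (fine Lc M') (Fib d)) (hfμ : Function.Injective fμ)
    (hμ : ∀ a : μ, ∃ m : Fin (d + 1), (fμ a).2 = Sum.inr m)
    (hcoarse : ∀ (s : ↥(pbox (fine Lc M'))) (m : Fin (d + 1)),
      ((s, Sum.inr m) : Idx (fine Lc M') (Fib d)) ∈ Set.range fμ ↔ Torus.proj Lc (s : Site (d + 1)) = 0)
    (g : μ → ↥(pbox M') × Fin (d + 1))
    (hg : ∀ a, ((fμ a).1 : Site (d + 1)) = (Lc : ℤ) • ((g a).1 : Site (d + 1)) ∧ (fμ a).2 = Sum.inr (g a).2) :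
    (effForm ((perF (fine Lc M') Mh).submatrix
          (fun b : ↥(pbox (fine Lc M')) × Fin (d + 1) => ((b.1, Sum.inl b.2) : Idx (fine Lc M') (Fib d)))
          (fun b : ↥(pbox (fine Lc M')) × Fin (d + 1) => ((b.1, Sum.inl b.2) : Idx (fine Lc M') (Fib d))))
        (fromRows
          ((perF (fine Lc M') Mh).submatrix fμ
            (fun b : ↥(pbox (fine Lc M')) × Fin (d + 1) => ((b.1, Sum.inl b.2) : Idx (fine Lc M') (Fib d))))
          ((combRowsT (toSite r) Lc (fine Lc M')).submatrix id
            (fun b : ↥(pbox (fine Lc M')) × Fin (d + 1) => ((b.1, Sum.inl b.2) : Idx (fine Lc M') (Fib d)))))).toBlocks₁₁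
      = w⁻¹ • (perF M' Mh').submatrix
          (fun a : μ => (((g a).1, Sum.inl (g a).2) : Idx M' (Fib d))) (fun a : μ => (((g a).1, Sum.inl (g a).2) : Idx M' (Fib d))) := by
  rw [effForm_toBlocks₁₁_of_relInv (fine Lc M') hr (fun i => Dvd.intro (M' i) rfl) hA hMh hAt hMt hrel hmm hanti fμ hfμ hμ hcoarse,
    perF_coarse_inr_inr_eq_of_read M' hAmm fμ g hg]
  ext a a'
  rw [submatrix_apply, Matrix.smul_apply, submatrix_apply, perF_inl_inl_of_ff M' hff, smul_eq_mul, ← mul_assoc, inv_mul_cancel₀ hw, one_mul]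

set_option synthInstance.maxSize 1024 in
/-- **[folklore] (H2) THE SECOND (INV) LETTER AS A THEOREM, ANY PAIR OF CHARTS** (`RelInvPeriodisedEffFormCoarse.torus_h2` with both charts displayed): the fine chart
`(A, 𝕄)` on `fine Lc M′` at root `toSite r` with letters (iv)(v) towards the coarse bordered Hessian `𝕄′`, and the coarse chart `(A′, 𝕄′)` on `M′` at root `toSite r′`
(`Lc ∣ M′_i`), `g` BIJECTIVE, coarse one-step rows by any injective `fμ′` (`hμ′ hcoarse′`):
`det kkt ((effForm H₀ [Q₁₀;τ₁]).toBlocks₁₁) [M̂′∘(fμ′, fields∘g); combRowsT (toSite r′) Lc M′∘(·, fields∘g)] ≠ 0`. -/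
theorem torus_h2_of_relInv (hr : r ∈ box (d + 1) Lc) (hA : Spr A) (hMh : Spr Mh)
    (hAt : ∀ t : Fin (d + 1) → ℤ, shiftK ((Lc : ℤ) • t) A = A) (hMt : ∀ t : Fin (d + 1) → ℤ, shiftK ((Lc : ℤ) • t) Mh = Mh)
    (hrel : RelInv A Mh (axEc (toSite r) Lc))
    (hmm : ∀ (x y : Fin (d + 1) → ℤ) (κ l : Fin (d + 1)), Mh x y (Sum.inr κ) (Sum.inr l) = 0)
    (hanti : ∀ (x y : Fin (d + 1) → ℤ) (κ l : Fin (d + 1)), Mh x y (Sum.inl κ) (Sum.inr l) = -Mh y x (Sum.inr l) (Sum.inl κ))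
    (hAmm : ∀ (x y : Fin (d + 1) → ℤ) (m m' : Fin (d + 1)),
      A ((Lc : ℤ) • x) ((Lc : ℤ) • y) (Sum.inr m) (Sum.inr m') = K₂ x y (Sum.inl m) (Sum.inl m'))
    (hff : ∀ (x y : Fin (d + 1) → ℤ) (κ l : Fin (d + 1)), Mh' x y (Sum.inl κ) (Sum.inl l) = w * K₂ x y (Sum.inl κ) (Sum.inl l)) (hw : w ≠ 0)
    (hr' : r' ∈ box (d + 1) Lc) (hM' : ∀ i, Lc ∣ M' i) (hA' : Spr A') (hMh' : Spr Mh')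
    (hAt' : ∀ t : Fin (d + 1) → ℤ, shiftK ((Lc : ℤ) • t) A' = A') (hMt' : ∀ t : Fin (d + 1) → ℤ, shiftK ((Lc : ℤ) • t) Mh' = Mh')
    (hrel' : RelInv A' Mh' (axEc (toSite r') Lc))
    (hmm' : ∀ (x y : Fin (d + 1) → ℤ) (κ l : Fin (d + 1)), Mh' x y (Sum.inr κ) (Sum.inr l) = 0)
    (hanti' : ∀ (x y : Fin (d + 1) → ℤ) (κ l : Fin (d + 1)), Mh' x y (Sum.inl κ) (Sum.inr l) = -Mh' y x (Sum.inr l) (Sum.inl κ))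
    {μ : Type*} [Fintype μ] [DecidableEq μ] (fμ : μ → Idx (fine Lc M') (Fib d)) (hfμ : Function.Injective fμ)
    (hμ : ∀ a : μ, ∃ m : Fin (d + 1), (fμ a).2 = Sum.inr m)
    (hcoarse : ∀ (s : ↥(pbox (fine Lc M'))) (m : Fin (d + 1)),
      ((s, Sum.inr m) : Idx (fine Lc M') (Fib d)) ∈ Set.range fμ ↔ Torus.proj Lc (s : Site (d + 1)) = 0)
    (g : μ → ↥(pbox M') × Fin (d + 1))
    (hg : ∀ a, ((fμ a).1 : Site (d + 1)) = (Lc : ℤ) • ((g a).1 : Site (d + 1)) ∧ (fμ a).2 = Sum.inr (g a).2)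
    (hgb : Function.Bijective g)
    {κ : Type*} [Fintype κ] [DecidableEq κ] (fμ' : κ → Idx M' (Fib d)) (hfμ' : Function.Injective fμ')
    (hμ' : ∀ a : κ, ∃ m : Fin (d + 1), (fμ' a).2 = Sum.inr m)
    (hcoarse' : ∀ (s : ↥(pbox M')) (m : Fin (d + 1)), ((s, Sum.inr m) : Idx M' (Fib d)) ∈ Set.range fμ' ↔ Torus.proj Lc (s : Site (d + 1)) = 0) :
    (kkt
      (effForm ((perF (fine Lc M') Mh).submatrix
            (fun b : ↥(pbox (fine Lc M')) × Fin (d + 1) => ((b.1, Sum.inl b.2) : Idx (fine Lc M') (Fib d)))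
            (fun b : ↥(pbox (fine Lc M')) × Fin (d + 1) => ((b.1, Sum.inl b.2) : Idx (fine Lc M') (Fib d))))
          (fromRows
            ((perF (fine Lc M') Mh).submatrix fμ
              (fun b : ↥(pbox (fine Lc M')) × Fin (d + 1) => ((b.1, Sum.inl b.2) : Idx (fine Lc M') (Fib d))))
            ((combRowsT (toSite r) Lc (fine Lc M')).submatrix id
              (fun b : ↥(pbox (fine Lc M')) × Fin (d + 1) => ((b.1, Sum.inl b.2) : Idx (fine Lc M') (Fib d)))))).toBlocks₁₁
      (fromRows
        ((perF M' Mh').submatrix fμ' (fun a : μ => (((g a).1, Sum.inl (g a).2) : Idx M' (Fib d))))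
        ((combRowsT (toSite r') Lc M').submatrix (Equiv.refl _) (fun a : μ => (((g a).1, Sum.inl (g a).2) : Idx M' (Fib d)))))).det ≠ 0 := by
  refine coarse_det_kkt_ne_zero_of_relInv M' hr' hM' hA' hMh' hAt' hMt' hrel' hmm' hanti' fμ' hfμ' hμ' hcoarse'
    (fun a : μ => (((g a).1, Sum.inl (g a).2) : Idx M' (Fib d))) ?_ (fun a => ⟨(g a).2, rfl⟩) ?_ (Equiv.refl _) (inv_ne_zero hw)
    (hId_order_zero_of_relInv M' hr hA hMh hAt hMt hrel hmm hanti hAmm hff hw fμ hfμ hμ hcoarse g hg) rfl rfl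
  · intro a a' h
    simp only [Prod.mk.injEq, Sum.inl.injEq] at h
    exact hgb.1 (Prod.ext h.1 h.2)
  · intro s α
    obtain ⟨a, ha⟩ := hgb.2 (s, α)
    exact ⟨a, show (((g a).1, Sum.inl (g a).2) : Idx M' (Fib d)) = (s, Sum.inl α) by rw [ha]⟩

end Identification

end Summit.QuantumFields.BalabanUV.Beta.FP.RelInvPeriodisedChartEffForm

end
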